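import Summits.BirchSwinnertonDyer.Rank1Residual.Additive.StrictSignedSelmer
import Summits.BirchSwinnertonDyer.Rank1Residual.AdditivePotMult.PrimeToPDescent
import HarnessLib

/-!
# (P5-3a) Kummer invisibility of the torsion clause, and the cochain lemma
# (`cells/n1011/skel/T-O7ss-P5.md` §2 (D4c): the two generic inputs of the Kummer dictionary)
(cell `b2b-bsdres`, team n1011, seat n1011-p17 GEN 7; row T-O7ss-P13 follow-up (P5), file P5-3a;
designs (A)(B) APPROVED by referee-1 GEN 22; this file is independent of the transports P5-1/P5-2)

HONEST FRAMING (cell `b2b-bsdres`, run/shared/lean/b2b/bsd-rank1-residual/, verbatim in every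
file): the goal of the cell is to DELETE the COMBINATION-SHAPED residual classes of the
Birch–Swinnerton-Dyer formula for ALL analytic-rank `≤ 1` elliptic curves over `ℚ` — "full BSD
formula for every rank `≤ 1` curve in class `C`" assembled STRICTLY from published theorems — so
that the rank-`≤ 1` remainder becomes exactly the CONSTRUCTION-SHAPED classes, which are TYPED
(missing-input `Prop`s), NOT attempted. This is not "finishing BSD". Research route on
O7-ss ∩ (G)∧ss ∩ e = 2 (OPEN) / X4 CONSTRUCTION-SHAPED; nothing here is booked; no label moves.
TOOL THEOREMS ONLY: no definition, no named Literature fact, no `sorry`; axioms standard.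


## What is proved
* §8 `signed_inf_ker_le_strictSigned` (`E^{−,0}_W(n) ≤ E^{−,str}_W(n)`) and
  **`localKummerOverOfEmb_strictSigned_eq_zeroClause`**: for a CLOSED `H ≤ Γ_ℚ` the Kummer local
  condition cut out by p17 F2a's STRICT group (`Tr_{n/0}(pᵏQ)` torsion) EQUALS the one cut out by
  the ZERO-clause group (`Tr_{n/0}(pᵏQ) = 0`) — F2a's docstring claim "the Selmer groups do not see
  the difference", now a theorem (witness surgery `(φ, Q, k) ↦ (N'φ, N'Q, k + a)`, `N' ≡ 1 mod p^{j+1}`);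
* §9 **`cochain_index_nsmul_eq`** (G1): for `N ⊴ B` of finite index `d` acting on `M` and a crossed
  homomorphism `ψ : B → M` principal on `N` (`ψ a = aQ − Q`), `d • ψ τ = τ Q₂ − Q₂` on all of `B`
  with the EXPLICIT `Q₂ = ∑_{q ∈ B/N} q̃Q − ∑_q ψ(q̃)` — the corestriction-free bookkeeping behind
  "the kernel of restriction is killed by the index".

References: S. Kobayashi, Invent. Math. 152 (2003) §2 p. 4, Def. 1.1, Def. 2.1 [Kobayashi2003];
J.-P. Serre, *Galois Cohomology* I.§2.4 [SerreGaloisCohomology1997].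
-/

noncomputable section

open scoped Classical

open WeierstrassCurve Field

namespace Summit.BirchSwinnertonDyer.Rank1Residual.Additive.SignedTwist

open Literature.NumberTheory.EllipticCurves Literature.NumberTheory.GaloisRepresentations
  Literature.NumberTheory.EllipticCurves.Kobayashi2003
  Summit.BirchSwinnertonDyer.Rank1Residual.AdditivePotMult

/-! ## §8 (D4c, part 1) Kummer invisibility of the torsion clause -/

section Invisibility

open ZpExtension

variable (W : WeierstrassCurve ℚ) (p : ℕ) [Fact p.Prime] (κ : ZpExtension ℚ p)
  {E : Type} [Field E] [Algebra ℚ E] (ι : AlgebraicClosure ℚ →ₐ[ℚ] AlgebraicClosure E)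

omit [Algebra ℚ E] in
/-- The Galois action commutes with `ℕ`-multiples. [folklore] -/
theorem galSmul_nsmul {A : Type*} [AddCommGroup A] [DistribMulAction (absoluteGaloisGroup E) A]
    (τ : absoluteGaloisGroup E) (k : ℕ) (a : A) : τ • (k • a) = k • (τ • a) :=
  map_nsmul (DistribSMul.toAddMonoidHom A τ) k a

/-- The ZERO-clause group `E^{−,0}_W(n) = E⁻_W(n) ⊓ ker Tr_{n/0}` sits inside p17's strict group
(torsion clause). [folklore] -/
theorem signed_inf_ker_le_strictSigned (n : ℕ) :
    signedLocalPointsOfEmb κ ι W (-1) n ⊓ (localTraceOfEmb κ ι W 0 n).ker ≤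
      strictSignedLocalPointsOfEmb κ ι W (-1) n := fun P hP ↦
  ⟨hP.1, fun _ ↦ by rw [(AddMonoidHom.mem_ker).mp hP.2]; exact zero_mem _⟩

/-- **KUMMER INVISIBILITY of the torsion clause** (F2a's docstring claim, now a theorem): for a CLOSED
`H ≤ Γ_ℚ` (so that `H¹(H, W[p^∞])` is `p`-primary), the Kummer condition cut out by p17's strict
group `E^{−,str}_W(n)` (`Tr_{n/0}(pᵏQ)` TORSION) equals the one cut out by the zero-clause group
`E^{−,0}_W(n)` (`Tr_{n/0}(pᵏQ) = 0`): if `Tr_{n/0}(pᵏQ)` has order `pᵃ·M`, `p ∤ M`, replace the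
witness `(φ, Q, k)` by `(N'φ, N'Q, k+a)` with `N' = uM ≡ 1 mod p^{j+1}`, `p^{j} c = 0`.
[cite: Kobayashi2003, §2 p. 4, Def. 2.1 (p. 5)] -/
theorem localKummerOverOfEmb_strictSigned_eq_zeroClause (H : Subgroup (absoluteGaloisGroup ℚ))
    (hH : IsClosed (H : Set (absoluteGaloisGroup ℚ))) (n : ℕ) :
    localKummerOverOfEmb W p H ι (strictSignedLocalPointsOfEmb κ ι W (-1) n) =
      localKummerOverOfEmb W p H ι
        (signedLocalPointsOfEmb κ ι W (-1) n ⊓ (localTraceOfEmb κ ι W 0 n).ker) := by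
  have hp : p.Prime := Fact.out
  refine le_antisymm ?_ (localKummerOverOfEmb_mono (signed_inf_ker_le_strictSigned W p κ ι n))
  rintro c ⟨φ, Q, k, hc, hA, hφ⟩
  obtain ⟨hP, hT⟩ := (mem_strictSignedLocalPointsOfEmb_iff κ ι W (-1) n _).mp hA
  set T := localTraceOfEmb κ ι W 0 n ((p ^ k) • Q) with hTdef
  have hTfin : IsOfFinAddOrder T := (AddCommGroup.mem_torsion _).mp (hT rfl)
  -- `addOrderOf T = p ^ a * M`, `p ∤ M`
  obtain ⟨a, M, hM, hNM⟩ :=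
    Nat.exists_eq_pow_mul_and_not_dvd hTfin.addOrderOf_pos.ne' p hp.one_lt.ne'
  -- `c` is `p`-primary: `p ^ (j+1) • c = 0`
  obtain ⟨j, hj⟩ := exists_pow_nsmul_eq_zero_subgroupH1_of_isClosed W p hH c
  have hj1 : p ^ (j + 1) • c = 0 := by rw [pow_succ', mul_nsmul', hj, nsmul_zero]
  -- `N' = M * u ≡ 1 mod p^(j+1)`
  have hcop : Nat.Coprime M (p ^ (j + 1)) :=
    (Nat.Coprime.pow_right (j + 1) ((Nat.Prime.coprime_iff_not_dvd hp).mpr hM).symm)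
  obtain ⟨u, -, hu⟩ := Nat.exists_mul_mod_eq_one_of_coprime hcop
    (Nat.one_lt_pow (Nat.succ_ne_zero j) hp.one_lt)
  set N' := M * u with hN'
  have hN'c : N' • c = c := by
    have h := Nat.div_add_mod N' (p ^ (j + 1))
    rw [hu] at h
    calc N' • c = (p ^ (j + 1) * (N' / p ^ (j + 1)) + 1) • c := by rw [h]
      _ = c := by rw [add_nsmul, one_nsmul, mul_nsmul, hj1, nsmul_zero, zero_add]
  -- the new witness
  refine ⟨(N' : ℤ) • φ, N' • Q, k + a, ?_, ?_, fun τ ↦ ?_⟩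
  · rw [← oneCocycleClassₗ_apply, map_zsmul, oneCocycleClassₗ_apply, hc, natCast_zsmul, hN'c]
  · have hQ : p ^ (k + a) • N' • Q = (p ^ a * N') • (p ^ k • Q) := by
      rw [smul_smul, smul_smul]; congr 1; ring
    rw [hQ]
    refine AddSubgroup.mem_inf.mpr ⟨AddSubgroup.nsmul_mem _ hP _, (AddMonoidHom.mem_ker).mpr ?_⟩
    rw [map_nsmul, ← hTdef, hN', show p ^ a * (M * u) = u * (p ^ a * M) by ring,
      mul_nsmul', ← hNM, addOrderOf_nsmul_eq_zero, nsmul_zero]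
  · have hval : (((N' : ℤ) • φ).1 (resGalSubgroupOfEmb H ι τ) : W.geomPrimaryTorsion p) =
        N' • (φ.1 (resGalSubgroupOfEmb H ι τ)) := by
      rw [Submodule.coe_smul, ContinuousMap.smul_apply, natCast_zsmul]
    rw [hval, AddSubmonoidClass.coe_nsmul, map_nsmul, hφ τ, smul_sub, galSmul_nsmul]

end Invisibility

/-! ## §9 (G1) the cochain lemma; (D4c →) `Kummer_W(strict) → Kummer_V(E⁻(K_n))` -/

section CochainLemma

/-- **(G1) THE COCHAIN LEMMA.** Let `B` act on `M`, `N ⊴ B` of finite index `d`, `ψ : B → M` a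
crossed homomorphism (`ψ(στ) = ψ σ + σ ψ τ`) which is PRINCIPAL on `N`: `ψ a = aQ − Q` (`a ∈ N`).
Then `d • ψ` is principal on all of `B`: `d • ψ τ = τ Q₂ − Q₂` with
`Q₂ = ∑_{q ∈ B/N} q̃ Q − ∑_q ψ(q̃)` (`q̃ = q.out`) — the explicit corestriction-free form of
"`res : H¹(B/N-coinvariants…)`, kernel of restriction killed by the index". [folklore] -/
theorem cochain_index_nsmul_eq {G : Type*} [Group G] {M : Type*} [AddCommGroup M]
    [DistribMulAction G M] {B : Subgroup G} (N : Subgroup B) [N.Normal] [Fintype (B ⧸ N)]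
    (ψ : B → M) (hψ : ∀ σ τ : B, ψ (σ * τ) = ψ σ + (σ : G) • ψ τ) (Q : M)
    (hQ : ∀ a : B, a ∈ N → ψ a = (a : G) • Q - Q) (τ : B) :
    Fintype.card (B ⧸ N) • ψ τ =
      (τ : G) • ((∑ q : B ⧸ N, ((q.out : B) : G) • Q) - ∑ q : B ⧸ N, ψ q.out) -
        ((∑ q : B ⧸ N, ((q.out : B) : G) • Q) - ∑ q : B ⧸ N, ψ q.out) := by
  classical
  set g : B ⧸ N := QuotientGroup.mk τ with hg
  have key : ∀ q : B ⧸ N, ψ τ = ψ (g * q).out + (τ : G) • (((q.out : B) : G) • Q) -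
      (((g * q).out : B) : G) • Q - (τ : G) • ψ q.out := by
    intro q
    have hmem : ((g * q).out)⁻¹ * (τ * q.out) ∈ N := QuotientGroup.eq.mp (by
      rw [QuotientGroup.out_eq', QuotientGroup.mk_mul, QuotientGroup.out_eq'])
    have h2 : ψ (τ * q.out) =
        ψ (g * q).out + (((g * q).out : B) : G) • ψ (((g * q).out)⁻¹ * (τ * q.out)) := by
      conv_lhs => rw [show τ * q.out = (g * q).out * (((g * q).out)⁻¹ * (τ * q.out)) by group]
      exact hψ _ _
    rw [hQ _ hmem, smul_sub, smul_smul, ← Subgroup.coe_mul, mul_inv_cancel_left, Subgroup.coe_mul,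
      mul_smul, hψ τ q.out] at h2
    calc ψ τ = (ψ τ + (τ : G) • ψ q.out) - (τ : G) • ψ q.out := by abel
      _ = _ := by rw [h2]; abel
  have hsum : ∑ _q : B ⧸ N, ψ τ = ∑ q : B ⧸ N, (ψ (g * q).out + (τ : G) • (((q.out : B) : G) • Q) -
      (((g * q).out : B) : G) • Q - (τ : G) • ψ q.out) := Finset.sum_congr rfl fun q _ ↦ key q
  rw [Finset.sum_const, Finset.card_univ] at hsum
  rw [hsum, Finset.sum_sub_distrib, Finset.sum_sub_distrib, Finset.sum_add_distrib, ← Finset.smul_sum,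
    ← Finset.smul_sum,
    show ∑ q : B ⧸ N, ψ (g * q).out = ∑ q : B ⧸ N, ψ q.out from
      Fintype.sum_equiv (Equiv.mulLeft g) _ _ fun q ↦ rfl,
    show ∑ q : B ⧸ N, (((g * q).out : B) : G) • Q = ∑ q : B ⧸ N, ((q.out : B) : G) • Q from
      Fintype.sum_equiv (Equiv.mulLeft g) _ _ fun q ↦ rfl, smul_sub]
  abel

end CochainLemma

end Summit.BirchSwinnertonDyer.Rank1Residual.Additive.SignedTwist
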